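import Summits.BirchSwinnertonDyer.BirchSwinnertonDyer.Theorems.ResidualThetaTransportAtTwoRlfTwistedPlusLocShiftMod
import Summits.BirchSwinnertonDyer.BirchSwinnertonDyer.Theorems.ResidualThetaTransportAtTwoRlfTwistedPlusCoinvOfHonda
import Summits.BirchSwinnertonDyer.BirchSwinnertonDyer.Theorems.ThetaPartnerAtTwoSignedControlAtTwoPlusLocEngine
import HarnessLib

/-!
# Road T for item 23110, brick (R3) = (T2)⁺: Step A of the TWISTED LOC ENGINE as a DATUM — from the twisted coinvariants
# «`((A ⊗ ℚ_p/ℤ_p)(χ_u))_Γ = 0`» and «`u·conj_g t − t` Kummer-from-`A`» to a twisted SHIFT datum `(φ, S, T)`; and the engine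
# MODULO the local `+` condition (consumable by a Prop. 4.13-type surjectivity); `p = 2` unconditional

Route `ResidualThetaTransportAtTwo` (RTT, crux r201 `ResidualLambdaFormulaNegDiscAtTwo`, stmt-BirchSwinnertonDyer-23110) /
`ThetaPartnerAtTwo` (TP2). Seat `prover-bsd-wall-tp2-p2x-w3` g12; `--supports stmt-BirchSwinnertonDyer-23110`. THEOREMS ONLY (no
definition, no named fact, no `sorry`); route-independent; closes nothing.

The `χ_u`-twin of K4's `SignedEC.exists_localLift_kummer_of_coinvariantsDiv` (`…PlusLocEngine`, Step A) on top of the twisted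
part 7 `exists_twistedTorsion_localLift_kummer_of_shift` (`…RlfTwistedPlusLocShift`, this seat):

* `exists_twistedShift_of_coinvariantsDivTwisted` — Step A as a datum (same hypotheses as `…RlfTwistedPlusLocEngine`'s engine):
  a cocycle `φ` of `t`, a point `S` with `p^j S ∈ A`, a `p`-power-torsion `T`, and the twisted shift relation
  `u·g f₁(g⁻¹τg) − f₁(τ) = τT − T` for `f₁ = ι φ(·|) − ∂S` on `G_∞`;
* `exists_twistedTorsion_localLift_kummer_of_coinvariantsDivTwisted_mod` — the twisted engine with the conclusion of
  `exists_twistedTorsion_localLift_kummer_of_shift_mod` (`…RlfTwistedPlusLocShiftMod`): for every global `y` whose `res_E y − x` is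
  TWISTED-KUMMER-from-`A` (the local `+` condition at level `J`), `t − twistedTorsionToH1 y` is Kummer-from-`A`;
* `exists_twistedTorsion_localLift_plusKummer_two_mod` — `p = 2`, `A = ⋃ₙ E⁺(ℚ_{2,n})`, UNCONDITIONAL for `GoodSS`, `a₂ = 0`, cyclotomic
  `κ` (`plusCoinvariantsDivTwisted_two`).

HONEST FRAMING: closes nothing; (R1), (R2), (R5), (R6) untouched; 23110 is NOT proved; BSD is not proved by any of this.
References: [GreenbergLNM1716] §4 Lemma 4.7 (pp. 107–108), p. 124; [BDKim2013] Props. 2.2–2.3, proof of Cor. 3.15;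
[Kobayashi2003] Def. 1.1, §8.4; [SerreGaloisCohomology1997] I §5.8.
-/

set_option autoImplicit false
-- the Theorems namespace of this sub repeats the summit name by design (D-0017 nested layout)
set_option linter.dupNamespace false

noncomputable section

open scoped Classical NumberField

open NumberField IsDedekindDomain CategoryTheory

universe u

namespace Summit.BirchSwinnertonDyer.BirchSwinnertonDyer.Theorems.SignedEC.TwistedLocalDescent

open Literature.NumberTheory.EllipticCurves Literature.NumberTheory.GaloisRepresentations
  WeierstrassCurve ZpExtension Literature.NumberTheory.EllipticCurves.Kobayashi2003
  Literature.NumberTheory.EllipticCurves.Sprung2012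

/-! ## §1 The twisted engine -/

section Engine

variable {K : Type u} [Field K] [NumberField K] (W : WeierstrassCurve K) [W.IsElliptic] {p : ℕ} [Fact p.Prime]
  (κ : ZpExtension K p) (E : Type u) [Field E] [Algebra K E]

omit [NumberField K] in
set_option maxHeartbeats 3200000 in
/-- **Step A of the twisted LOC engine, as a datum.** From (DIV_{A,u}) and «`u·conj_{g|} t − t` Kummer-from-`A`»: a cocycle `φ` of
`t`, a point `S` with `p^j S ∈ A`, a `p`-power-torsion `T`, and the twisted shift relation `u·g f₁(g⁻¹τg) − f₁(τ) = τT − T` for the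
shifted local values `f₁ = ι φ(·|) − ∂S` on `G_∞` (the Kummer datum `(Q, k)` of the twisted coboundary, (DIV_{A,u}) at
`x' = p^{k'} Q'`, a `p^j`-th root `S` of `y`, `T = Q' − (u·g S − S) − w`). [cite: GreenbergLNM1716, §4 Lemma 4.7 (pp. 107–108), p. 124]
[cite: BDKim2013, Props. 2.2–2.3] -/
theorem exists_twistedShift_of_coinvariantsDivTwisted
    (A : AddSubgroup (localPoints W E)) {g : Field.absoluteGaloisGroup E} {u : ℤ}
    (hdiv : ∀ x ∈ A, ∀ k : ℕ, ∃ y ∈ A, ∃ j : ℕ, ∃ w ∈ localTowerPointsOfEmb κ (closureEmb (K := K) E) W,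
      p ^ j • x - p ^ k • (u • g • y - y) = p ^ (j + k) • w)
    (t : W.subgroupH1 p κ.kerSubgroup)
    (ht : u • W.conjH1 p κ.kerSubgroup (resGal (K := K) E g) t - t ∈
      localKummerOverOfEmb W p κ.kerSubgroup (closureEmb (K := K) E) A) :
    ∃ (φ : contOneCocycles (discreteTopRep κ.kerSubgroup (W.geomPrimaryTorsion p))) (S T : localPoints W E),
      oneCocycleClass _ φ = t ∧ (∃ j : ℕ, p ^ j • S ∈ A) ∧ (∃ n : ℕ, p ^ n • T = 0) ∧
      ∀ τ τ' : localSubgroupOfEmb κ.kerSubgroup (closureEmb (K := K) E),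
        (τ' : Field.absoluteGaloisGroup E) = g⁻¹ * τ * g →
        u • g • (pointsMapOfEmb W (closureEmb (K := K) E)
            ((φ.1 ⟨resGalOfEmb (closureEmb (K := K) E) τ', τ'.2⟩ : W.geomPrimaryTorsion p) : W.geomPoints) -
          ((τ' : Field.absoluteGaloisGroup E) • S - S)) -
        (pointsMapOfEmb W (closureEmb (K := K) E)
            ((φ.1 ⟨resGalOfEmb (closureEmb (K := K) E) τ, τ.2⟩ : W.geomPrimaryTorsion p) : W.geomPoints) -
          ((τ : Field.absoluteGaloisGroup E) • S - S)) = (τ : Field.absoluteGaloisGroup E) • T - T := by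
  -- notation and generalities (as in the untwisted engine)
  set ι : AlgebraicClosure K →ₐ[K] AlgebraicClosure E := closureEmb (K := K) E with hι
  set M : AddSubgroup (localPoints W E) := localTowerPointsOfEmb κ ι W with hM
  have hMfix : ∀ {P : localPoints W E}, P ∈ M →
      ∀ τ : Field.absoluteGaloisGroup E, τ ∈ localSubgroupOfEmb κ.kerSubgroup ι → τ • P = P :=
    fun {P} hP ↦ (mem_localTowerPointsOfEmb_iff κ ι W P).1 hP
  have hconj : ∀ (σ τ : Field.absoluteGaloisGroup E), τ ∈ localSubgroupOfEmb κ.kerSubgroup ι →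
      σ⁻¹ * τ * σ ∈ localSubgroupOfEmb κ.kerSubgroup ι := by
    intro σ τ hτ
    rw [mem_localSubgroupOfEmb_iff] at hτ ⊢
    rw [map_mul, map_mul, map_inv]
    exact κ.kerSubgroup_normal.conj_mem' _ hτ _
  have hGmem : ∀ {u : Field.absoluteGaloisGroup E}, u ∈ localSubgroupOfEmb κ.kerSubgroup ι →
      resGalOfEmb ι u ∈ κ.kerSubgroup := fun {u} hu ↦ (mem_localSubgroupOfEmb_iff _ ι u).1 hu
  have galois_smul_nsmul : ∀ (τ : Field.absoluteGaloisGroup E) (n : ℕ) (P : localPoints W E),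
      τ • (n • P) = n • (τ • P) := fun τ n P ↦ map_nsmul (DistribSMul.toAddMonoidHom (localPoints W E) τ) n P
  have galois_smul_zsmul : ∀ (τ : Field.absoluteGaloisGroup E) (n : ℤ) (P : localPoints W E),
      τ • (n • P) = n • (τ • P) := fun τ n P ↦ map_zsmul (DistribSMul.toAddMonoidHom (localPoints W E) τ) n P
  -- Step 0: a cocycle `φ` of `t`; its local values `f0` on `G_∞`
  obtain ⟨φ, rfl⟩ := oneCocycleClass_surjective (discreteTopRep κ.kerSubgroup (W.geomPrimaryTorsion p)) t
  obtain ⟨f0, hf0⟩ : ∃ f0 : ∀ u : Field.absoluteGaloisGroup E, u ∈ localSubgroupOfEmb κ.kerSubgroup ι →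
      localPoints W E, ∀ u hu, f0 u hu =
      pointsMapOfEmb W ι ((φ.1 ⟨resGalOfEmb ι u, hGmem hu⟩ : W.geomPrimaryTorsion p) : W.geomPoints) :=
    ⟨_, fun _ _ ↦ rfl⟩
  -- Step A: unpack `u·conj_γ t − t ∈ Kummer(A)` (γ = res g) at the cocycle level
  let φg : contOneCocycles (discreteTopRep κ.kerSubgroup (W.geomPrimaryTorsion p)) :=
    contOneCocycles.pullback (subgroupConj κ.kerSubgroup (resGalOfEmb ι g))
      (resHomOfEquivariant (subgroupConj κ.kerSubgroup (resGalOfEmb ι g))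
        (DistribSMul.toAddMonoidHom (W.geomPrimaryTorsion p) (resGalOfEmb ι g))
        (ZpExtension.conj_compat κ.kerSubgroup (resGalOfEmb ι g))) φ
  have hconjφ : W.conjH1 p κ.kerSubgroup (resGal (K := K) E g) (oneCocycleClass _ φ) = oneCocycleClass _ φg :=
    map_oneCocycleClass _ _ _ φ
  have hzs : u • oneCocycleClass (discreteTopRep κ.kerSubgroup (W.geomPrimaryTorsion p)) φg =
      oneCocycleClass _ (u • φg) := by
    rw [← oneCocycleClassₗ_apply (φ := φg), ← map_zsmul, oneCocycleClassₗ_apply]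
  rw [hconjφ, hzs, ← oneCocycleClass_sub] at ht
  obtain ⟨ψ, Q, k, hψ, hQA, hcob⟩ := ht
  have hψ0 : oneCocycleClass (discreteTopRep κ.kerSubgroup (W.geomPrimaryTorsion p)) (ψ - (u • φg - φ)) = 0 := by
    rw [oneCocycleClass_sub, sub_eq_zero]; exact hψ
  rw [oneCocycleClass_eq_zero_iff] at hψ0
  obtain ⟨R₀, hR₀⟩ := hψ0
  -- `ψ h = (u·γ φ(γ⁻¹ h γ) − φ h) + (h R₀ − R₀)` for `h ∈ ker κ`
  have hψφ : ∀ h : κ.kerSubgroup, (ψ.1 h : W.geomPrimaryTorsion p) =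
      (u • (resGalOfEmb ι g • φ.1 (subgroupConj κ.kerSubgroup (resGalOfEmb ι g) h)) - φ.1 h) +
        ((h : Field.absoluteGaloisGroup K) • R₀ - R₀) := by
    intro h
    have h1 := hR₀ h
    rw [Submodule.coe_sub, ContinuousMap.sub_apply, Submodule.coe_sub, ContinuousMap.sub_apply, Submodule.coe_smul,
      ContinuousMap.smul_apply, contOneCocycles.pullback_apply, sub_eq_iff_eq_add, discreteTopRep_ρ_apply,
      Subgroup.smul_def] at h1
    rw [h1, add_comm]
    rfl
  -- on `G_∞`: `u·g f0 (g⁻¹ τ g) − f0 τ = τ Q' − Q'` with `Q' = Q − ι R₀`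
  have hgconj_mem : ∀ {τ : Field.absoluteGaloisGroup E}, τ ∈ localSubgroupOfEmb κ.kerSubgroup ι →
      g⁻¹ * τ * g ∈ localSubgroupOfEmb κ.kerSubgroup ι := fun {τ} hτ ↦ hconj g τ hτ
  obtain ⟨R₀', hR₀'⟩ : ∃ R₀' : localPoints W E,
      R₀' = pointsMapOfEmb W ι ((R₀ : W.geomPrimaryTorsion p) : W.geomPoints) := ⟨_, rfl⟩
  obtain ⟨Q', hQ'⟩ : ∃ Q' : localPoints W E, Q' = Q - R₀' := ⟨_, rfl⟩
  have hA1 : ∀ (τ : Field.absoluteGaloisGroup E) (hτ : τ ∈ localSubgroupOfEmb κ.kerSubgroup ι),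
      u • g • f0 (g⁻¹ * τ * g) (hgconj_mem hτ) - f0 τ hτ = τ • Q' - Q' := by
    intro τ hτ
    have h1 := hcob ⟨τ, hτ⟩
    change pointsMapOfEmb W ι _ = τ • Q - Q at h1
    have h2 := hψφ (resGalSubgroupOfEmb κ.kerSubgroup ι ⟨τ, hτ⟩)
    have hsc : (subgroupConj κ.kerSubgroup (resGalOfEmb ι g) (resGalSubgroupOfEmb κ.kerSubgroup ι ⟨τ, hτ⟩) :
        κ.kerSubgroup) = ⟨resGalOfEmb ι (g⁻¹ * τ * g), hGmem (hgconj_mem hτ)⟩ := by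
      apply Subtype.ext
      show _ = resGalOfEmb ι (g⁻¹ * τ * g)
      rw [subgroupConj_apply_coe, resGalSubgroupOfEmb_apply_coe, map_mul, map_mul, map_inv]
    have hre : (resGalSubgroupOfEmb κ.kerSubgroup ι ⟨τ, hτ⟩ : κ.kerSubgroup) =
        ⟨resGalOfEmb ι τ, hGmem hτ⟩ := rfl
    rw [hsc, hre] at h2
    have h3 := congrArg (fun z : W.geomPrimaryTorsion p ↦ pointsMapOfEmb W ι (z : W.geomPoints)) h2
    simp only at h3
    rw [hre] at h1
    rw [h1, AddSubgroup.coe_add, map_add, AddSubgroup.coe_sub, map_sub, AddSubgroup.coe_sub, map_sub,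
      AddSubgroupClass.coe_zsmul, map_zsmul, primaryComponent.coe_smul, pointsMapOfEmb_smul,
      primaryComponent.coe_smul, pointsMapOfEmb_smul, ← hf0 _ (hgconj_mem hτ), ← hf0 τ hτ, ← hR₀'] at h3
    -- `h3 : τ Q − Q = (u·g f0 (g⁻¹τg) − f0 τ) + (τ R₀' − R₀')`
    rw [hQ', smul_sub]
    have h4 : u • g • f0 (g⁻¹ * τ * g) (hgconj_mem hτ) - f0 τ hτ = (τ • Q - Q) - (τ • R₀' - R₀') := by
      rw [h3]; abel
    rw [h4]; abel
  -- a power of `p` killing `R₀`; `k' = k + m₀`, `x' = p^{k'} Q' = p^{m₀} (p^k Q) ∈ A`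
  obtain ⟨m₀, hm₀⟩ : ∃ m₀ : ℕ, p ^ m₀ • R₀ = 0 := by
    obtain ⟨m₀, hm⟩ := AddCommGroup.mem_primaryComponent.mp R₀.2
    exact ⟨m₀, Subtype.ext (by rw [AddSubmonoidClass.coe_nsmul, hm, ZeroMemClass.coe_zero])⟩
  have hR₀'tors : p ^ m₀ • R₀' = 0 := by
    rw [hR₀', ← map_nsmul, ← AddSubmonoidClass.coe_nsmul, hm₀, ZeroMemClass.coe_zero, map_zero]
  obtain ⟨k', hk'⟩ : ∃ k' : ℕ, k' = k + m₀ := ⟨_, rfl⟩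
  obtain ⟨x', hx'⟩ : ∃ x' : localPoints W E, x' = p ^ k' • Q' := ⟨_, rfl⟩
  have hx'eq : x' = p ^ m₀ • (p ^ k • Q) := by
    have e1 : p ^ k' • R₀' = 0 := by rw [hk', pow_add, mul_smul, hR₀'tors, smul_zero]
    rw [hx', hQ', smul_sub, e1, sub_zero, hk', pow_add, mul_comm, mul_smul]
  have hx'A : x' ∈ A := by rw [hx'eq]; exact AddSubgroup.nsmul_mem _ hQA _
  -- (DIV_{A,u}) at `x'`, `k'`: `p^j x' − p^{k'} (u·g y − y) = p^{j+k'} w`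
  obtain ⟨y, hyA, j, w, hwM, hdiv'⟩ := hdiv x' hx'A k'
  -- a `p^j`-th root `S` of `y`, and the torsion point `T = Q' − (u·g S − S) − w`
  obtain ⟨S, hS⟩ := W.nsmul_surjective_localPoints E (pow_ne_zero j (Fact.out : p.Prime).ne_zero) y
  simp only at hS
  obtain ⟨T, hT⟩ : ∃ T : localPoints W E, T = Q' - (u • g • S - S) - w := ⟨_, rfl⟩
  have hTtors : p ^ (j + k') • T = 0 := by
    have e1 : p ^ (j + k') • Q' = p ^ j • x' := by rw [hx', pow_add, mul_smul]
    have e2 : p ^ (j + k') • (u • g • S - S) = p ^ k' • (u • g • y - y) := by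
      rw [pow_add, mul_comm, mul_smul, smul_sub (p ^ j), smul_comm (p ^ j) u (g • S), smul_comm (p ^ j) g S, hS]
    rw [hT, smul_sub, smul_sub, e1, e2, hdiv', sub_self]
  -- (iii) twisted `g`-invariance up to the coboundary of the torsion point `T`
  have hf1conj : ∀ (τ : Field.absoluteGaloisGroup E) (hτ : τ ∈ localSubgroupOfEmb κ.kerSubgroup ι),
      u • g • (f0 (g⁻¹ * τ * g) (hgconj_mem hτ) - ((g⁻¹ * τ * g) • S - S)) - (f0 τ hτ - (τ • S - S)) =
        τ • T - T := by
    intro τ hτ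
    have e1 : g • ((g⁻¹ * τ * g) • S - S) = τ • g • S - g • S := by
      rw [smul_sub, ← mul_smul, show g * (g⁻¹ * τ * g) = τ * g by group, mul_smul]
    have e2 : τ • w = w := hMfix hwM τ hτ
    have e3 := hA1 τ hτ
    have e4 : τ • T - T = (τ • Q' - Q') - ((τ • (u • g • S) - u • g • S) - (τ • S - S)) := by
      rw [hT, smul_sub, smul_sub, smul_sub, e2]; abel
    rw [smul_sub g, e1, smul_sub u, smul_sub u, ← galois_smul_zsmul τ u (g • S), e4, ← e3]
    abel
  -- the datum
  refine ⟨φ, S, T, rfl, ⟨j, by rw [hS]; exact hyA⟩, ⟨j + k', hTtors⟩, fun τ τ' hτ' ↦ ?_⟩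
  have e : τ' = ⟨g⁻¹ * τ * g, hgconj_mem τ.2⟩ := Subtype.ext hτ'
  subst e
  have h := hf1conj τ.1 τ.2
  rw [hf0 _ (hgconj_mem τ.2), hf0 τ.1 τ.2] at h
  exact h

end Engine

/-! ## §2 The twisted engine MODULO the local `+` condition; `p = 2` unconditionally -/

section EngineMod

variable {K : Type u} [Field K] [NumberField K] (W : WeierstrassCurve K) [W.IsElliptic] {p : ℕ} [Fact p.Prime]
  (κ : ZpExtension K p) (E : Type u) [Field E] [Algebra K E]

/-- **The twisted LOC engine modulo the local `+` condition.** (DIV_{A,u}) + «`u·conj_{g|} t − t` Kummer-from-`A`» ⟹ eventually in `J`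
some `x ∈ H¹(Γ_E, E[p^J](χ_u))` such that for every global `y` whose `res_E y − x` is twisted-Kummer-from-`A`,
`t − twistedTorsionToH1 y` is Kummer-from-`A` (Step A `exists_twistedShift_of_coinvariantsDivTwisted` + Steps B–D
`exists_twistedTorsion_localLift_kummer_of_shift_mod`). [cite: GreenbergLNM1716, §4 Lemma 4.7 (pp. 107–108), p. 124]
[cite: BDKim2013, Props. 2.2–2.3] -/
theorem exists_twistedTorsion_localLift_kummer_of_coinvariantsDivTwisted_mod
    (A : AddSubgroup (localPoints W E))
    (hAM : A ≤ localTowerPointsOfEmb κ (closureEmb (K := K) E) W)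
    {g : Field.absoluteGaloisGroup E} (hg : κ.IsTopGenerator (resGal (K := K) E g))
    {u : ℤ} (hu : (p : ℤ) ∣ u - 1)
    (hdiv : ∀ x ∈ A, ∀ k : ℕ, ∃ y ∈ A, ∃ j : ℕ, ∃ w ∈ localTowerPointsOfEmb κ (closureEmb (K := K) E) W,
      p ^ j • x - p ^ k • (u • g • y - y) = p ^ (j + k) • w)
    (t : W.subgroupH1 p κ.kerSubgroup)
    (ht : u • W.conjH1 p κ.kerSubgroup (resGal (K := K) E g) t - t ∈
      localKummerOverOfEmb W p κ.kerSubgroup (closureEmb (K := K) E) A) :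
    ∃ J₀ : ℕ, ∀ J : ℕ, J₀ ≤ J →
      ∃ x : galoisCohomology ((W.twistedTorsionGaloisModule p κ J u hu).restrictField E) 1,
        ∀ y : galoisCohomology (W.twistedTorsionGaloisModule p κ J u hu) 1,
          (∃ (ζ : contOneCocycles ((W.twistedTorsionGaloisModule p κ J u hu).restrictField E).toTopRep)
              (Q : localPoints W E) (m : ℕ),
            oneCocycleClass _ ζ = galoisCohomology.res (W.twistedTorsionGaloisModule p κ J u hu) E 1 y - x ∧
            p ^ m • Q ∈ A ∧
            ∀ τ : localSubgroupOfEmb κ.kerSubgroup (closureEmb (K := K) E),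
              pointsMap W E ((ζ.1 (τ : Field.absoluteGaloisGroup E) : geomTorsion W ((p ^ J : ℕ) : ℤ)) : geomPoints W) =
                (τ : Field.absoluteGaloisGroup E) • Q - Q) →
          t - W.twistedTorsionToH1 p κ J u hu y ∈
            localKummerOverOfEmb W p κ.kerSubgroup (closureEmb (K := K) E) A := by
  obtain ⟨φ, S, T, hφt, hSA, hTt, hshift⟩ :=
    exists_twistedShift_of_coinvariantsDivTwisted W κ E A hdiv t ht
  subst hφt
  exact exists_twistedTorsion_localLift_kummer_of_shift_mod W κ E A hAM hg hu φ S T hSA hTt hshift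

end EngineMod

section TwoMod

variable (W : WeierstrassCurve ℚ) [W.IsElliptic] [W.IsGloballyMinimal] (κ : ZpExtension ℚ 2)

/-- **(R3) = (T2)⁺ at `p = 2` MODULO the local `+` condition, unconditionally** (`GoodSS W 2`, `a₂ = 0`, cyclotomic `κ`, `v ∋ 2`, `g`
restricting to the topological generator, `u` odd, `A = ⋃ₙ E⁺(ℚ_{2,n})`; (DIV_{A,u}) is `plusCoinvariantsDivTwisted_two`): for every
`t` with `u·conj_{g|} t − t` `+`-Kummer at `v`, eventually in `J` some `x ∈ H¹(Γ_{ℚ_v}, E[2^J](χ_u))` has «`res_v y − x` twisted-`+`-Kummer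
⇒ `t − twistedTorsionToH1 y` `+`-Kummer» for all global `y`. [cite: GreenbergLNM1716, §4 Lemma 4.7 (pp. 107–108), p. 124]
[cite: BDKim2013, Props. 2.2–2.3] [cite: Kobayashi2003, §8.4] -/
theorem exists_twistedTorsion_localLift_plusKummer_two_mod (hss : Rank1Residual.GoodSS W 2) (ha : W.frobeniusTrace 2 = 0)
    (hκ : κ.IsCyclotomic) (v : HeightOneSpectrum (𝓞 ℚ)) (hv : (2 : 𝓞 ℚ) ∈ v.asIdeal)
    {g : Field.absoluteGaloisGroup (v.adicCompletion ℚ)} (hg : κ.IsTopGenerator (resGal (K := ℚ) (v.adicCompletion ℚ) g))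
    {u : ℤ} (hu : ((2 : ℕ) : ℤ) ∣ u - 1) (t : W.subgroupH1 2 κ.kerSubgroup)
    (ht : u • W.conjH1 2 κ.kerSubgroup (resGal (K := ℚ) (v.adicCompletion ℚ) g) t - t ∈
      localKummerOverOfEmb W 2 κ.kerSubgroup (closureEmb (K := ℚ) (v.adicCompletion ℚ))
        (⨆ n, signedLocalPoints κ (v.adicCompletion ℚ) W 1 n)) :
    ∃ J₀ : ℕ, ∀ J : ℕ, J₀ ≤ J →
      ∃ x : galoisCohomology ((W.twistedTorsionGaloisModule 2 κ J u hu).restrictField (v.adicCompletion ℚ)) 1,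
        ∀ y : galoisCohomology (W.twistedTorsionGaloisModule 2 κ J u hu) 1,
          (∃ (ζ : contOneCocycles ((W.twistedTorsionGaloisModule 2 κ J u hu).restrictField (v.adicCompletion ℚ)).toTopRep)
              (Q : localPoints W (v.adicCompletion ℚ)) (m : ℕ),
            oneCocycleClass _ ζ =
                galoisCohomology.res (W.twistedTorsionGaloisModule 2 κ J u hu) (v.adicCompletion ℚ) 1 y - x ∧
            2 ^ m • Q ∈ (⨆ n, signedLocalPoints κ (v.adicCompletion ℚ) W 1 n) ∧
            ∀ τ : localSubgroupOfEmb κ.kerSubgroup (closureEmb (K := ℚ) (v.adicCompletion ℚ)),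
              pointsMap W (v.adicCompletion ℚ)
                  ((ζ.1 (τ : Field.absoluteGaloisGroup (v.adicCompletion ℚ)) : geomTorsion W ((2 ^ J : ℕ) : ℤ)) :
                    geomPoints W) =
                (τ : Field.absoluteGaloisGroup (v.adicCompletion ℚ)) • Q - Q) →
          t - W.twistedTorsionToH1 2 κ J u hu y ∈
            localKummerOverOfEmb W 2 κ.kerSubgroup (closureEmb (K := ℚ) (v.adicCompletion ℚ))
              (⨆ n, signedLocalPoints κ (v.adicCompletion ℚ) W 1 n) := by
  have hAM := iSup_signedLocalPointsOfEmb_le_localTowerPointsOfEmb W κ 1 (closureEmb (K := ℚ) (v.adicCompletion ℚ))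
  have hg' : κ.IsTopGenerator (resGalOfEmb (closureEmb (K := ℚ) (v.adicCompletion ℚ)) g) := hg
  have hDIV := plusCoinvariantsDivTwisted_two W hss ha hκ v hv hg' (by exact_mod_cast hu)
  refine exists_twistedTorsion_localLift_kummer_of_coinvariantsDivTwisted_mod W κ (v.adicCompletion ℚ)
    (⨆ n, signedLocalPoints κ (v.adicCompletion ℚ) W 1 n) hAM hg hu ?_ t ht
  intro x hx k
  obtain ⟨y, hy, w, hw, h⟩ := hDIV x hx k
  exact ⟨y, hy, k, w, hAM hw, h⟩

end TwoMod

end Summit.BirchSwinnertonDyer.BirchSwinnertonDyer.Theorems.SignedEC.TwistedLocalDescent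

end
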